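import Summits.BirchSwinnertonDyer.BirchSwinnertonDyer.Theorems.PrintCf2SplitBadTwoRestrictedSelmerLocalTrivialAwayFromP
import Literature.NumberTheory.EllipticCurves.SubgroupSelmerCocycleCriteriaProofs
import HarnessLib

/-!
# Crux `PrintCf2.SplitBadTwoRankOneOfFacts` (stmt-BirchSwinnertonDyer-20368), road α v10.3, S3c bottom value — THE LOCAL HALF OF (H2):
# at a place `w` where `E(K_w)/tors` is a LINE through a global point `P`, every class CLASSICAL AT `w` restricts on `D_w` to an INTEGER
# MULTIPLE of the restriction of a Kummer class of `P` (Agboola 2007 Prop. 6.11: «`E(K_{𝔭*}) ⊗ D_{𝔭*}` cocyclic ⟹ `loc` onto» for `r = 1`)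

Cell `bsd-print-cf2`, width seat `bsd-line-cf2-p1-w7` g3 (file 4 of the seat; -w7 g2's bottom-value lane, memo
`Cruxes/SplitBadTwoRankOneOfFacts/BOTTOM-VALUE-SNAKE-w7g2-v2.md` §2 (H2)); `--supports stmt-BirchSwinnertonDyer-20368` (helper, Theses-free).
HONEST FRAMING: nothing here closes a crux or a stub; BSD is not proved by any of this; no summit statement is proved by this seat. No definition,
no named fact, no `sorry`, no kit. beyond-print theorem: no.

WHAT. `exists_resOfLe_eq_zsmul_resOfLe_kummer`: for an elliptic curve `V` over a number field `K`, a prime `p`, a finite place `w`, a point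
`P ∈ V(K)` and the RANK-ONE RELATION at `w` («for every `Γ_{K_w}`-fixed `y ∈ E(K̄_w)` there is `a` with, for every `K'`,
`p^a y − M·P − p^{K'} y' ∈ E(K̄_w)_tors` for some `M ∈ ℤ`, `y'` fixed» — supplied at the dyadic places of the S3c frame by
`LocalPointsScalar.exists_rankOne_rel_adicCompletion_two`, Silverman VII.6.3 at `[K_w : ℚ_p] = 1`): EVERY class `c ∈ H¹(⊤, E[p^∞])` satisfying the
classical local condition at `w` (`localKerOver p ⊤ K_w`: it dies in `H¹(Γ_{K_w}, E(K̄_w))`) restricts on `⊤ ⊓ D_w` to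
`M • res_{D_w}(res_⊤ κ_n(P))` for some `n` and `M ∈ ℤ` (`κ_n = kummerMapLevel`, `= kummerMapPInfty (P ⊗ e_n)`).
PROOF (Greenberg LNM 1716 §2 / the template of -w7 g2's `localKerOver_top_le_awayKer`): the cocycle is `τ ↦ τQ − Q` with `y := p^N Q` rational;
the relation at depth `K' = N + a` and a global root `p^{N+a} Q_P = P` make `S := m'·(Q − M Q_P − y')` a torsion point (`m = p^j m'` the order of
the defect, `p ∤ m'`), hence ALGEBRAIC (`torsionPointsEquiv`); so `m'·(φ − M φ_P)` is the coboundary of `S` on `D_w`, while `p^{N+a}` kills both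
classes; Bézout (`gcd(m', p) = 1`) gives `res φ = M · res φ_P`.

References: A. Agboola, Compositio 143 (2007) = arXiv math/0602192 §6 Prop. 6.11 (p0014) [Agboola2007]; R. Greenberg, LNM 1716 (1999) §2
Prop. 2.1–2.2, p. 62 (Kummer map) [GreenbergLNM1716]; J.-P. Serre, *Galois Cohomology* I.§2.4 [SerreGaloisCohomology1997].
-/

noncomputable section

open scoped Classical

set_option linter.dupNamespace false -- `Summit.BirchSwinnertonDyer.BirchSwinnertonDyer` (summit = problem) is the tree's layout
set_option autoImplicit false

open NumberField IsDedekindDomain Field WeierstrassCurve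
open Literature.NumberTheory.EllipticCurves Literature.NumberTheory.EllipticCurves.GreenbergSelmer
open Literature.NumberTheory.EllipticCurves.ResKernel Literature.NumberTheory.EllipticCurves.CocycleCriteria
open Literature.NumberTheory.GaloisRepresentations

universe u

namespace Summit.BirchSwinnertonDyer.BirchSwinnertonDyer.Theorems.PrintCf2.RestrictedSelmerPair

section LocalRankOne

variable {K : Type u} [Field K] [NumberField K] (V : WeierstrassCurve K) [V.IsElliptic] (p : ℕ) [Fact p.Prime]
  (w : HeightOneSpectrum (𝓞 K)) (P : V.toAffine.Point)

set_option maxHeartbeats 400000 in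
/-- **A class classical at `w` is, on `D_w`, an integer multiple of a Kummer class of `P`** when `E(K_w)/tors` is a line through `P`
(hypothesis `hrel`: for every `Γ_{K_w}`-fixed `y`, some `p^a y ≡ M P (mod p^{K'} E(K̄_w)^{Γ} + tors)` for all `K'`):
`res_{D_w} c = M • res_{D_w}(res_⊤ κ_n(P))`. [cite: Agboola2007, Prop. 6.11 (arXiv p0014)] [cite: GreenbergLNM1716, §2 Prop. 2.1 and p. 62] -/
theorem exists_resOfLe_eq_zsmul_resOfLe_kummer
    (hrel : ∀ y : localPoints V (w.adicCompletion K), (∀ σ : absoluteGaloisGroup (w.adicCompletion K), σ • y = y) →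
      ∃ a : ℕ, ∀ K' : ℕ, ∃ (M : ℤ) (y' : localPoints V (w.adicCompletion K)),
        (∀ σ : absoluteGaloisGroup (w.adicCompletion K), σ • y' = y') ∧
        IsOfFinAddOrder (((p : ℤ) ^ a) • y - M • pointsMap V (w.adicCompletion K) (toGeomPoints V P) - ((p : ℤ) ^ K') • y'))
    {c : subgroupH1 (⊤ : Subgroup (absoluteGaloisGroup K)) (V.geomPrimaryTorsion p)}
    (hc : c ∈ V.localKerOver p ⊤ (w.adicCompletion K)) :
    ∃ (n : ℕ) (M : ℤ), resOfLe (V.geomPrimaryTorsion p) (inf_le_left : ⊤ ⊓ decomp w ≤ ⊤) c =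
      M • resOfLe (V.geomPrimaryTorsion p) (inf_le_left : ⊤ ⊓ decomp w ≤ ⊤)
        (resSubgroup ⊤ (V.geomPrimaryTorsion p) (V.kummerMapLevel p V.zsmul_geomPoints_surjective_holds n P)) := by
  -- notation
  set E := w.adicCompletion K with hE
  set ι := closureEmb (K := K) (w.adicCompletion K) with hι
  obtain ⟨φ, rfl⟩ := oneCocycleClass_surjective (discreteTopRep (⊤ : Subgroup (absoluteGaloisGroup K)) (V.geomPrimaryTorsion p)) c
  -- the classical condition: `ι φ(res τ) = τQ - Q` on `Γ_{K_w}`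
  have hc' : resH1Hom (resGalSubgroupOfEmb ⊤ ι) ((pointsMapOfEmb V ι).comp (V.geomPrimaryTorsion p).subtype)
      (fun τ P ↦ by
        simp only [AddMonoidHom.coe_comp, AddSubgroup.coe_subtype, Function.comp_apply, Subgroup.smul_def,
          resGalSubgroupOfEmb_apply_coe, Literature.NumberTheory.EllipticCurves.primaryComponent.coe_smul]
        exact pointsMapOfEmb_smul V ι τ P)
      (oneCocycleClass _ φ) = 0 := hc
  rw [resH1Hom_oneCocycleClass_eq_zero_iff] at hc'
  obtain ⟨Q, hQ⟩ := hc'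
  have hQ' : ∀ σ : absoluteGaloisGroup E, pointsMapOfEmb V ι ((φ.1 (resGalSubgroupOfEmb ⊤ ι ⟨σ, (mem_localSubgroupOfEmb_iff ⊤ ι σ).mpr
      (Subgroup.mem_top _)⟩) : V.geomPrimaryTorsion p) : V.geomPoints) = σ • Q - Q :=
    fun σ ↦ hQ ⟨σ, (mem_localSubgroupOfEmb_iff ⊤ ι σ).mpr (Subgroup.mem_top _)⟩
  -- finite image: `p^N φ = 0`
  haveI : CompactSpace (absoluteGaloisGroup K) := compactSpace_absoluteGaloisGroup K
  haveI : CompactSpace (⊤ : Subgroup (absoluteGaloisGroup K)) :=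
    isCompact_iff_compactSpace.mp (by rw [Subgroup.coe_top]; exact isCompact_univ)
  obtain ⟨N, hN⟩ := exists_pow_smul_apply_eq_zero (p := p) φ.1 (fun g ↦ by
    obtain ⟨k, hk⟩ := (AddCommGroup.mem_primaryComponent).mp (φ.1 g).2
    exact ⟨k, Subtype.ext (by rw [AddSubmonoidClass.coe_nsmul, ZeroMemClass.coe_zero]; exact hk)⟩)
  -- `y := p^N Q` is `Γ_{K_w}`-rational
  have hy : ∀ σ : absoluteGaloisGroup E, σ • ((p ^ N : ℕ) • Q) = (p ^ N : ℕ) • Q := by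
    intro σ
    rw [smul_comm, ← sub_eq_zero, ← smul_sub, ← hQ' σ, ← map_nsmul, ← AddSubmonoidClass.coe_nsmul, hN, ZeroMemClass.coe_zero,
      map_zero]
  -- rank one: `p^a y ≡ M P_loc (mod p^(N+a) E(K_w) + tors)`
  obtain ⟨a, ha⟩ := hrel _ hy
  obtain ⟨M, y', hy', htor⟩ := ha (N + a)
  set n := N + a with hn
  -- the global root `Q_P`, `p^n Q_P = P`, and its local image
  set QP := V.kummerRoot p V.zsmul_geomPoints_surjective_holds n P with hQP
  have hnQP : p ^ n • QP = toGeomPoints V P := V.nsmul_kummerRoot p V.zsmul_geomPoints_surjective_holds n P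
  set QPloc := pointsMap V E QP with hQPloc
  -- the torsion point `D` and its order `m = p^j m'`
  obtain ⟨m, hm0, hmD⟩ := isOfFinAddOrder_iff_nsmul_eq_zero.mp htor
  obtain ⟨j, m', hm', hmm'⟩ := Nat.exists_eq_pow_mul_and_not_dvd hm0.ne' p (Fact.out : p.Prime).ne_one
  refine ⟨n, M, ?_⟩
  -- `S := m' • (Q − M • Q_P,loc − y')` is killed by `p^(n+j)`, hence algebraic
  set X : localPoints V E := Q - M • QPloc - y' with hXdef
  set S : localPoints V E := m' • X with hSdef
  have h1 : (p ^ n : ℕ) • Q = ((p : ℤ) ^ a) • ((p ^ N : ℕ) • Q) := by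
    rw [hn, pow_add, mul_comm, ← smul_smul, ← natCast_zsmul, Nat.cast_pow]
  have h2 : (p ^ n : ℕ) • (M • QPloc) = M • pointsMap V E (toGeomPoints V P) := by
    rw [smul_comm, hQPloc, ← map_nsmul, hnQP]
  have h3 : (p ^ n : ℕ) • y' = ((p : ℤ) ^ n) • y' := by rw [← natCast_zsmul, Nat.cast_pow]
  have hX : (p ^ n : ℕ) • X = ((p : ℤ) ^ a) • ((p ^ N : ℕ) • Q) - M • pointsMap V E (toGeomPoints V P) - ((p : ℤ) ^ n) • y' := by
    rw [hXdef, smul_sub, smul_sub, h1, h2, h3]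
  have hS : (((p ^ (n + j) : ℕ) : ℤ)) • S = 0 := by
    rw [natCast_zsmul, hSdef, smul_smul, show p ^ (n + j) * m' = m * p ^ n by rw [hmm']; ring, ← smul_smul, hX, hmD]
  have hnz : ((p ^ (n + j) : ℕ) : ℤ) ≠ 0 := by exact_mod_cast (pow_pos (Fact.out : p.Prime).pos _).ne'
  set T : AddSubgroup.torsionBy (localPoints V E) ((p ^ (n + j) : ℕ) : ℤ) :=
    ⟨S, by change ((p ^ (n + j) : ℕ) : ℤ) • S = 0; exact hS⟩ with hTdef
  set t : V.geomTorsion ((p ^ (n + j) : ℕ) : ℤ) := (V.torsionPointsEquiv ((p ^ (n + j) : ℕ) : ℤ) (E := E) hnz).symm T with htdef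
  have ht : pointsMap V E (t : V.geomPoints) = S := by
    rw [htdef, V.pointsMap_torsionPointsEquiv_symm]
  have htp : (t : V.geomPoints) ∈ V.geomPrimaryTorsion p := by
    refine (AddCommGroup.mem_primaryComponent).mpr ⟨n + j, ?_⟩
    have h2 := t.2
    change ((p ^ (n + j) : ℕ) : ℤ) • (t : V.geomPoints) = 0 at h2
    rw [natCast_zsmul] at h2
    exact h2
  -- the Kummer cocycle of `P` at level `n`, restricted to `⊤`
  have hQPfix : ∀ σ : absoluteGaloisGroup K, σ • (p ^ n • QP) = p ^ n • QP := smul_nsmul_of_nsmul_eq V p hnQP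
  set ψP := contOneCocycles.pullback (Literature.NumberTheory.EllipticCurves.subgroupIncl (⊤ : Subgroup (absoluteGaloisGroup K)))
    (resHomOfEquivariant (Literature.NumberTheory.EllipticCurves.subgroupIncl (⊤ : Subgroup (absoluteGaloisGroup K))) (AddMonoidHom.id (V.geomPrimaryTorsion p))
      (fun _ _ ↦ rfl)) (V.kummerCocycle p n QP hQPfix) with hψP
  have hκ : resSubgroup ⊤ (V.geomPrimaryTorsion p) (V.kummerMapLevel p V.zsmul_geomPoints_surjective_holds n P) =
      oneCocycleClass _ ψP := by
    rw [hψP, ← resSubgroup_oneCocycleClass]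
    rfl
  have hψP_apply : ∀ g : (⊤ : Subgroup (absoluteGaloisGroup K)), ((ψP.1 g : V.geomPrimaryTorsion p) : V.geomPoints) =
      (g : absoluteGaloisGroup K) • QP - QP := fun g ↦ rfl
  rw [hκ]
  -- abbreviations for the two restricted classes
  set A := resOfLe (V.geomPrimaryTorsion p) (inf_le_left : ⊤ ⊓ decomp w ≤ ⊤) (oneCocycleClass _ φ) with hA
  set B := resOfLe (V.geomPrimaryTorsion p) (inf_le_left : ⊤ ⊓ decomp w ≤ ⊤) (oneCocycleClass _ ψP) with hB
  -- (i) `p^n • A = 0`, (ii) `p^n • B = 0`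
  have hφn : ∀ g, p ^ n • φ.1 g = 0 := fun g ↦ by
    rw [hn, pow_add, mul_comm, mul_smul, hN, smul_zero]
  have hnA : ((p : ℤ) ^ n) • A = 0 := by
    have h0 : p ^ n • φ = 0 := by
      apply Subtype.ext; ext g
      rw [AddSubmonoidClass.coe_nsmul, ContinuousMap.coe_nsmul, Pi.smul_apply, hφn]
      rfl
    rw [← Nat.cast_pow, natCast_zsmul, hA, ← map_nsmul, ← oneCocycleClassₗ_apply, ← map_nsmul, h0, map_zero, map_zero]
  have hnB : ((p : ℤ) ^ n) • B = 0 := by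
    have h0 : p ^ n • ψP = 0 := by
      apply Subtype.ext; ext g
      rw [AddSubmonoidClass.coe_nsmul, ContinuousMap.coe_nsmul, Pi.smul_apply, AddSubmonoidClass.coe_nsmul, hψP_apply, smul_sub,
        smul_comm, hQPfix, sub_self]
      rfl
    rw [← Nat.cast_pow, natCast_zsmul, hB, ← map_nsmul, ← oneCocycleClassₗ_apply, ← map_nsmul, h0, map_zero, map_zero]
  -- (iii) `m' • A − (m' M) • B = 0`: the cocycle `m' φ − m' M ψP` is the coboundary of `t` on `D_w`
  set ζ := (m' : ℤ) • φ - ((m' : ℤ) * M) • ψP with hζ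
  have hζ_apply : ∀ g : (⊤ : Subgroup (absoluteGaloisGroup K)), ((ζ.1 g : V.geomPrimaryTorsion p) : V.geomPoints) =
      (m' : ℤ) • ((φ.1 g : V.geomPrimaryTorsion p) : V.geomPoints) - ((m' : ℤ) * M) • ((g : absoluteGaloisGroup K) • QP - QP) := by
    intro g
    rw [hζ, Submodule.coe_sub, Submodule.coe_smul_of_tower, Submodule.coe_smul_of_tower, ContinuousMap.sub_apply,
      ContinuousMap.smul_apply, ContinuousMap.smul_apply, AddSubgroupClass.coe_sub, AddSubgroupClass.coe_zsmul,
      AddSubgroupClass.coe_zsmul, hψP_apply]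
  have hζ0 : resOfLe (V.geomPrimaryTorsion p) (inf_le_left : ⊤ ⊓ decomp w ≤ ⊤) (oneCocycleClass _ ζ) = 0 := by
    rw [resOfLe_oneCocycleClass_eq_zero_iff]
    refine ⟨⟨(t : V.geomPoints), htp⟩, fun g ↦ ?_⟩
    obtain ⟨σ, hσ⟩ := (mem_decomp_iff w (g : absoluteGaloisGroup K)).mp (Subgroup.mem_inf.mp g.2).2
    have hg : (Subgroup.inclusion (inf_le_left : ⊤ ⊓ decomp w ≤ ⊤) g : (⊤ : Subgroup (absoluteGaloisGroup K))) =
        resGalSubgroupOfEmb ⊤ ι ⟨σ, (mem_localSubgroupOfEmb_iff ⊤ ι σ).mpr (Subgroup.mem_top _)⟩ := by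
      apply Subtype.ext
      rw [resGalSubgroupOfEmb_apply_coe]
      exact hσ.symm
    apply Subtype.ext
    apply pointsMapOfEmb_injective V ι
    rw [hζ_apply, map_sub, map_zsmul, map_zsmul, hg, hQ' σ, AddSubgroupClass.coe_sub,
      Literature.NumberTheory.EllipticCurves.primaryComponent.coe_smul, map_sub, map_sub, ← hσ, resGalSubgroupOfEmb_apply_coe]
    change (m' : ℤ) • (σ • Q - Q) - ((m' : ℤ) * M) • (pointsMap V E (resGal (K := K) E σ • QP) - pointsMap V E QP) =
      pointsMap V E (resGal (K := K) E σ • (t : V.geomPoints)) - pointsMap V E (t : V.geomPoints)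
    rw [pointsMap_smul, pointsMap_smul, ht, hSdef, hXdef, ← hQPloc]
    have hσS : σ • (m' • (Q - M • QPloc - y')) = m' • (σ • Q - M • (σ • QPloc) - y') := by
      change DistribSMul.toAddMonoidHom (localPoints V E) σ (m' • (Q - M • QPloc - y')) = _
      rw [map_nsmul, map_sub, map_sub, map_zsmul]
      change m' • (σ • Q - M • (σ • QPloc) - σ • y') = _
      rw [hy' σ]
    rw [hσS, ← natCast_zsmul, ← natCast_zsmul]
    generalize σ • Q = SQ
    generalize σ • QPloc = SQP
    module
  have hζc : resOfLe (V.geomPrimaryTorsion p) (inf_le_left : ⊤ ⊓ decomp w ≤ ⊤) (oneCocycleClass _ ζ) =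
      (m' : ℤ) • A - ((m' : ℤ) * M) • B := by
    rw [hA, hB, hζ, ← oneCocycleClassₗ_apply, map_sub, map_zsmul, map_zsmul, oneCocycleClassₗ_apply, oneCocycleClassₗ_apply,
      map_sub, map_zsmul, map_zsmul]
  have hiii : (m' : ℤ) • (A - M • B) = 0 := by
    rw [zsmul_sub, smul_smul, ← hζc, hζ0]
  -- (iv) Bézout: `gcd(m', p^n) = 1`
  have hcop : IsCoprime (m' : ℤ) ((p : ℤ) ^ n) := by
    have h : Nat.Coprime m' (p ^ n) :=
      (Nat.coprime_comm.mp ((Nat.Prime.coprime_iff_not_dvd (Fact.out : p.Prime)).mpr hm')).pow_right n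
    exact_mod_cast Nat.isCoprime_iff_coprime.mpr h
  obtain ⟨u, v, huv⟩ := hcop
  have hnAB : ((p : ℤ) ^ n) • (A - M • B) = 0 := by rw [zsmul_sub, smul_comm, hnA, hnB, zsmul_zero, sub_zero]
  rw [← sub_eq_zero]
  calc A - M • B = (1 : ℤ) • (A - M • B) := (one_zsmul _).symm
    _ = (u * (m' : ℤ) + v * (p : ℤ) ^ n) • (A - M • B) := by rw [huv]
    _ = 0 := by rw [add_zsmul, mul_zsmul, mul_zsmul, hiii, hnAB, zsmul_zero, zsmul_zero, add_zero]

end LocalRankOne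

end Summit.BirchSwinnertonDyer.BirchSwinnertonDyer.Theorems.PrintCf2.RestrictedSelmerPair

end
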